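import Summits.CriticalPhenomena.PercolationContinuityZ3.Theorems.PercNearOneGluingNoHeavyRsw3InvasionCheckedLabels
import Summits.CriticalPhenomena.PercolationContinuityZ3.Theorems.PercNearOneGluingNoHeavyRsw3InvasionOutlets
import HarnessLib

/-!
# RSW3 lane (P2, gen 27): INVASION PERCOLATION XVI — CCN's Corollary with the printed constant `2d − 1`:
# `L_n ≤ Δ(n + 1) − n` (the `n` absorbed bonds are checked from both ends) and `limsup (Q_n(y) − Q_n(x))·n/(n+1) ≤ (Δ − 1)(y − x)`

builds on p205010 (kernel theorem, internal audit signed; external expert review pending) — NOT used in this file.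

Cell `prim-rsw3`, prover seat `prim-rsw3-p2` (gen 27), memo `run/shared/lean/prim/rsw3/P2-RSWLITE.md` §34.  Support file
(`--supports stmt-CriticalPhenomena-4575`); no definitions, no named facts, no sorries.  Notation of files XIV–XV (`E(I_n)` = checked edges, `L_n = |E(I_n)|`).

File XV proved CCN's Corollary (2.6) with the constant `Δ` (`= 2d` on `ℤ^d`) coming from the crude count `L_n ≤ Δ(n + 1)`.  CCN's printed constant is
`2d − 1` ("the obvious bound `(2d − 1) + (2d/n) ≥ L_n/n ≥ 1`"): each of the `n` absorbed bonds has BOTH endpoints invaded and is therefore counted twice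
in `Σ_{v ∈ I_n} deg(v)`.  This file supplies that double count and the sharpened corollary.

* `card_checked_add_le_sum_card_incidenceFinset` — `L_n + n ≤ Σ_{v ∈ I_n} |inc(v)|` (double counting over the checked edges; the absorbed edges are distinct and interior).
* **`card_checked_add_le`** — `L_n + n ≤ Δ(n + 1)` on a graph of degrees `≤ Δ`.
* **`ae_eventually_card_filter_acceptedLabel_mem_Ioc_le_sharp`** — a.s. `#{k ≤ n : x_k ∈ (x, y]} ≤ ((Δ − 1)(y − x) + ε)(n + 1)` for all large `n`;
  **`…_sharp_zd`** — on `ℤ^d`: `((2d − 1)(y − x) + ε)(n + 1)`, CCN's Corollary (2.6) as printed.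
* **`ae_tendsto_acceptanceRatio_above_criticalProb_zero`** (`ℤ^d`, `d ≥ 2`, `p_c < y ≤ 1`) — THE ACCEPTANCE PROFILE VANISHES ABOVE `p_c`:
  `#{k ≤ n : x_k ∈ (p_c, y]} / #{e ∈ E(I_n) : U_e ∈ (p_c, y]} → 0` a.s. — of the labels in `(p_c, y]` that the invasion EXAMINES (a fraction
  `≈ y − p_c` of all checked labels, file XV), it ACCEPTS a vanishing proportion (file XI) (CCN Thm 4.2, `a_n(x) → 0` for `x > p_c`, in counting form).

References: J. T. Chayes, L. Chayes, C. M. Newman, Comm. Math. Phys. 101 (1985) 383–407, Corollary to Prop. 2.1, eq. (2.6), (3.14) and Thm 4.2 [ChayesChayesNewman1985].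
-/

noncomputable section

namespace Summit.CriticalPhenomena.PercolationContinuityZ3.Theorems.Rsw3

open Finset MeasureTheory Filter Topology Literature.Probability.Percolation Literature.Probability.Percolation.Invasion
open scoped ENNReal

variable {V : Type*} [DecidableEq V] {G : SimpleGraph V} [G.LocallyFinite]

/-! ## §1 The absorbed bonds are checked from both ends -/

/-- **Double count of the checked edges**: `L_n + n ≤ Σ_{v ∈ I_n} |inc(v)|` on an infinite connected graph — every checked edge is incident to
at least one invaded vertex, and each of the `n` (distinct) absorbed edges to two. [cite: ChayesChayesNewman1985, (3.14) ((2d−1) + 2d/n ≥ L_n/n)] -/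
theorem card_checked_add_le_sum_card_incidenceFinset [Infinite V] (hG : G.Preconnected) (U : Sym2 V → ℝ) (o : V) (n : ℕ) :
    ((invasion G U o n).biUnion fun v => G.incidenceFinset v).card + n
      ≤ ∑ v ∈ invasion G U o n, (G.incidenceFinset v).card := by
  classical
  set S := invasion G U o n with hS
  set E := S.biUnion fun v => G.incidenceFinset v with hE
  -- the absorbed edges
  set f : ℕ → Sym2 V := fun k => match newDart G U (invasion G U o k) with
    | some a => s(a.1, a.2)
    | none => s(o, o) with hf
  have hsome : ∀ k, ∃ a, newDart G U (invasion G U o k) = some a := fun k =>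
    exists_newDart_eq_some (boundaryDarts_invasion_nonempty hG U o k)
  have hf_eq : ∀ k a, newDart G U (invasion G U o k) = some a → f k = s(a.1, a.2) := by
    intro k a ha; simp only [hf, ha]
  set A := (Finset.range n).image f with hA
  -- `A` has `n` elements (the absorbed edges are distinct)
  have hinj : Set.InjOn f ↑(Finset.range n) := by
    have key : ∀ k₁ k₂, k₁ < k₂ → f k₁ ≠ f k₂ := by
      intro k₁ k₂ hlt heq
      obtain ⟨a, ha⟩ := hsome k₁
      obtain ⟨b, hb⟩ := hsome k₂
      rw [hf_eq k₁ a ha, hf_eq k₂ b hb] at heq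
      have hmem := newDart_mem_invasion_of_lt hlt ha (o := o)
      have hb2 : b.2 ∉ invasion G U o k₂ := snd_not_mem_of_newDart hb
      rcases Sym2.eq_iff.1 heq with ⟨_, h2⟩ | ⟨h1, _⟩
      · exact hb2 (h2 ▸ hmem.2)
      · exact hb2 (h1 ▸ hmem.1)
    intro k₁ _ k₂ _ heq
    rcases lt_trichotomy k₁ k₂ with h | h | h
    · exact absurd heq (key k₁ k₂ h)
    · exact h
    · exact absurd heq.symm (key k₂ k₁ h)
  have hAcard : A.card = n := by rw [hA, card_image_of_injOn hinj, card_range]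
  -- every absorbed edge is checked and has two distinct invaded endpoints
  have hAprop : ∀ e ∈ A, e ∈ E ∧ 2 ≤ (S.filter fun v => e ∈ G.incidenceFinset v).card := by
    intro e he
    obtain ⟨k, hk, rfl⟩ := mem_image.1 he
    have hkn : k < n := mem_range.1 hk
    obtain ⟨a, ha⟩ := hsome k
    rw [hf_eq k a ha]
    have hadj := adj_of_newDart ha
    have hmem := newDart_mem_invasion_of_lt hkn ha (o := o)
    have h1 : a.1 ∈ S.filter fun v => s(a.1, a.2) ∈ G.incidenceFinset v :=
      mem_filter.2 ⟨hmem.1, (G.mem_incidenceFinset a.1 _).2 ⟨(SimpleGraph.mem_edgeSet G).2 hadj, Sym2.mem_mk_left _ _⟩⟩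
    have h2 : a.2 ∈ S.filter fun v => s(a.1, a.2) ∈ G.incidenceFinset v :=
      mem_filter.2 ⟨hmem.2, (G.mem_incidenceFinset a.2 _).2 ⟨(SimpleGraph.mem_edgeSet G).2 hadj, Sym2.mem_mk_right _ _⟩⟩
    refine ⟨mem_biUnion.2 ⟨a.1, hmem.1, (mem_filter.1 h1).2⟩, ?_⟩
    have hpair : ({a.1, a.2} : Finset V) ⊆ S.filter fun v => s(a.1, a.2) ∈ G.incidenceFinset v := by
      intro v hv
      rcases mem_insert.1 hv with rfl | hv
      · exact h1
      · rw [mem_singleton] at hv; subst hv; exact h2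
    calc 2 = ({a.1, a.2} : Finset V).card := (card_pair hadj.ne).symm
      _ ≤ _ := card_le_card hpair
  -- double counting
  have hdc : ∑ v ∈ S, (G.incidenceFinset v).card = ∑ e ∈ E, (S.filter fun v => e ∈ G.incidenceFinset v).card := by
    have h1 : ∀ v ∈ S, (G.incidenceFinset v).card = ∑ e ∈ E, if e ∈ G.incidenceFinset v then 1 else 0 := by
      intro v hv
      rw [sum_boole, filter_mem_eq_inter, inter_eq_right.2 (subset_biUnion_of_mem (fun v => G.incidenceFinset v) hv)]
      rfl
    rw [sum_congr rfl h1, sum_comm]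
    refine sum_congr rfl fun e _ => ?_
    rw [sum_boole]; rfl
  rw [hdc]
  -- each checked edge contributes ≥ 1, each absorbed edge ≥ 2
  have hAsub : A ⊆ E := fun e he => (hAprop e he).1
  calc E.card + n = (E \ A).card + A.card + A.card := by
        rw [card_sdiff_of_subset hAsub, hAcard, Nat.sub_add_cancel (hAcard ▸ card_le_card hAsub)]
    _ = ∑ _e ∈ E \ A, 1 + ∑ _e ∈ A, 2 := by simp [sum_const]; ring
    _ ≤ ∑ e ∈ E \ A, (S.filter fun v => e ∈ G.incidenceFinset v).card + ∑ e ∈ A, (S.filter fun v => e ∈ G.incidenceFinset v).card := by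
        gcongr with e he e he
        · rw [Finset.mem_sdiff] at he
          obtain ⟨v, hv, hev⟩ := mem_biUnion.1 he.1
          exact card_pos.2 ⟨v, mem_filter.2 ⟨hv, hev⟩⟩
        · exact (hAprop e he).2
    _ = ∑ e ∈ E, (S.filter fun v => e ∈ G.incidenceFinset v).card := by
        rw [← sum_union (disjoint_sdiff.symm), sdiff_union_of_subset hAsub]

/-- **`L_n + n ≤ Δ(n + 1)`**: on an infinite connected graph of degrees `≤ Δ`, the invasion has checked at most `Δ(n+1) − n` labels by time `n`.
[cite: ChayesChayesNewman1985, (3.14)] -/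
theorem card_checked_add_le [Infinite V] (hG : G.Preconnected) {Δ : ℕ} (hΔ : ∀ v, G.degree v ≤ Δ) (U : Sym2 V → ℝ) (o : V) (n : ℕ) :
    ((invasion G U o n).biUnion fun v => G.incidenceFinset v).card + n ≤ Δ * (n + 1) := by
  refine (card_checked_add_le_sum_card_incidenceFinset hG U o n).trans ?_
  calc ∑ v ∈ invasion G U o n, (G.incidenceFinset v).card ≤ ∑ _v ∈ invasion G U o n, Δ :=
        sum_le_sum fun v _ => by rw [SimpleGraph.card_incidenceFinset_eq_degree]; exact hΔ v
    _ = Δ * (n + 1) := by rw [sum_const, smul_eq_mul, card_invasion hG U o n, mul_comm]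

/-! ## §2 CCN's Corollary with the printed constant -/

variable [Countable V]

/-- **CCN's COROLLARY (2.6) WITH THE SHARP CONSTANT**: for `0 ≤ x ≤ y ≤ 1` and `ε > 0`, almost surely
`#{k ≤ n : x_k ∈ (x, y]} ≤ ((Δ − 1)(y − x) + ε)(n + 1)` for all large `n` (infinite connected graph of degrees `≤ Δ`).
[cite: ChayesChayesNewman1985, Corollary to Prop. 2.1, eq. (2.6) (limsup |Q_n(x) − Q_n(y)| ≤ (2d − 1)|x − y|)] -/
theorem ae_eventually_card_filter_acceptedLabel_mem_Ioc_le_sharp [Infinite V] (hG : G.Preconnected) {Δ : ℕ}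
    (hΔ : ∀ v, G.degree v ≤ Δ) (o : V) {x y : ℝ} (hx0 : 0 ≤ x) (hxy : x ≤ y) (hy1 : y ≤ 1) {ε : ℝ} (hε : 0 < ε) :
    ∀ᵐ U ∂(labelMeasure V), ∀ᶠ n : ℕ in atTop,
      (((Finset.range (n + 1)).filter fun k => acceptedLabel G U o k ∈ Set.Ioc x y).card : ℝ)
        ≤ (((Δ : ℝ) - 1) * (y - x) + ε) * (n + 1) := by
  filter_upwards [ae_eventually_abs_dev_le hG hΔ o hx0 (hxy.trans hy1) (by positivity : 0 < ε / 3),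
    ae_eventually_abs_dev_le hG hΔ o (hx0.trans hxy) hy1 (by positivity : 0 < ε / 3)] with U hUx hUy
  have hlarge : ∀ᶠ n : ℕ in atTop, (y - x) ≤ ε / 3 * ((n : ℝ) + 1) := by
    obtain ⟨N, hN⟩ := exists_nat_ge (3 * (y - x) / ε)
    refine eventually_atTop.2 ⟨N, fun n hn => ?_⟩
    have h1 : 3 * (y - x) / ε ≤ n := hN.trans (by exact_mod_cast hn)
    rw [div_le_iff₀ hε] at h1
    nlinarith
  filter_upwards [hUx, hUy, hlarge] with n hnx hny hn3
  set E := (invasion G U o n).biUnion fun v => G.incidenceFinset v with hE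
  have hL : (E.card : ℝ) + n ≤ Δ * (n + 1) := by exact_mod_cast card_checked_add_le hG hΔ U o n
  have h1 : ((Finset.range (n + 1)).filter fun k => acceptedLabel G U o k ∈ Set.Ioc x y).card
      ≤ (E.filter fun e => U e ∈ Set.Ioc x y).card :=
    card_filter_acceptedLabel_le_card_filter_incidence hG U o (Set.Ioc x y) n
  have h2 : ((E.filter fun e => U e ∈ Set.Ioc x y).card : ℝ)
      = (E.filter fun e => U e ≤ y).card - (E.filter fun e => U e ≤ x).card := by
    have hsub : (E.filter fun e => U e ≤ x) ⊆ E.filter fun e => U e ≤ y :=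
      fun e he => by rw [mem_filter] at he ⊢; exact ⟨he.1, he.2.trans hxy⟩
    have hsd : (E.filter fun e => U e ∈ Set.Ioc x y) = (E.filter fun e => U e ≤ y) \ E.filter fun e => U e ≤ x := by
      ext e; simp only [mem_filter, Finset.mem_sdiff, Set.mem_Ioc, not_and, not_le]
      constructor
      · rintro ⟨he, hxe, hey⟩; exact ⟨⟨he, hey⟩, fun _ => hxe⟩
      · rintro ⟨⟨he, hey⟩, h⟩; exact ⟨he, h he, hey⟩
    rw [hsd, card_sdiff_of_subset hsub, Nat.cast_sub (card_le_card hsub)]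
  have hdev : ∀ z : ℝ, ((E.filter fun e => U e ≤ z).card : ℝ) = z * E.card + ∑ e ∈ E, ((if U e ≤ z then (1 : ℝ) else 0) - z) := by
    intro z
    rw [sum_sub_distrib, sum_const, nsmul_eq_mul, mul_comm (E.card : ℝ) z, ← sum_boole]
    ring
  have hyx : 0 ≤ y - x := by linarith
  calc (((Finset.range (n + 1)).filter fun k => acceptedLabel G U o k ∈ Set.Ioc x y).card : ℝ)
      ≤ (E.filter fun e => U e ∈ Set.Ioc x y).card := by exact_mod_cast h1
    _ = (y - x) * E.card + (∑ e ∈ E, ((if U e ≤ y then (1 : ℝ) else 0) - y) - ∑ e ∈ E, ((if U e ≤ x then (1 : ℝ) else 0) - x)) := by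
        rw [h2, hdev y, hdev x]; ring
    _ ≤ (y - x) * ((Δ : ℝ) * (n + 1) - n) + (ε / 3 * (n + 1) + ε / 3 * (n + 1)) := by
        gcongr
        · linarith
        · exact (le_abs_self _).trans ((abs_sub _ _).trans (add_le_add hny hnx))
    _ = ((Δ : ℝ) - 1) * (y - x) * (n + 1) + (y - x) + (ε / 3 * (n + 1) + ε / 3 * (n + 1)) := by ring
    _ ≤ ((Δ : ℝ) - 1) * (y - x) * (n + 1) + ε / 3 * (n + 1) + (ε / 3 * (n + 1) + ε / 3 * (n + 1)) := by gcongr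
    _ = (((Δ : ℝ) - 1) * (y - x) + ε) * (n + 1) := by ring

/-! ## §3 `ℤ^d`: the constant `2d − 1` -/

section Zd

open Literature.Probability.LatticeModels

variable {d : ℕ}

/-- **CCN's Corollary (2.6) on `ℤ^d` AS PRINTED** (`d ≥ 1`, `0 ≤ x ≤ y ≤ 1`, `ε > 0`): almost surely
`#{k ≤ n : x_k ∈ (x, y]} ≤ ((2d − 1)(y − x) + ε)(n + 1)` for all large `n` — "`limsup |Q_n(x) − Q_n(y)| ≤ (2d − 1)|x − y|` with probability 1".
[cite: ChayesChayesNewman1985, Corollary to Prop. 2.1, eq. (2.6)] -/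
theorem ae_eventually_card_filter_acceptedLabel_mem_Ioc_le_sharp_zd (hd : 1 ≤ d) {x y : ℝ} (hx0 : 0 ≤ x) (hxy : x ≤ y) (hy1 : y ≤ 1)
    {ε : ℝ} (hε : 0 < ε) :
    ∀ᵐ U ∂(labelMeasure (Site d)), ∀ᶠ n : ℕ in atTop,
      (((Finset.range (n + 1)).filter fun k => acceptedLabel (zdGraph d) U 0 k ∈ Set.Ioc x y).card : ℝ)
        ≤ ((2 * (d : ℝ) - 1) * (y - x) + ε) * (n + 1) := by
  haveI : Nonempty (Fin d) := ⟨⟨0, hd⟩⟩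
  haveI : Infinite (Site d) := Pi.infinite_of_right
  have hΔ : ∀ v : Site d, (zdGraph d).degree v ≤ 2 * d := fun v => by
    rw [← SimpleGraph.card_neighborFinset_eq_degree, card_neighborFinset_zdGraph_holds v]
  have h := ae_eventually_card_filter_acceptedLabel_mem_Ioc_le_sharp zdGraph_preconnected_holds (Δ := 2 * d) hΔ 0 hx0 hxy hy1 hε
  have hcast : (((2 * d : ℕ) : ℝ) - 1) = 2 * (d : ℝ) - 1 := by push_cast; ring
  simpa only [hcast] using h

/-- **THE ACCEPTANCE PROFILE VANISHES ABOVE `p_c`** (`ℤ^d`, `d ≥ 2`, `p_c < y ≤ 1`): almost surely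
`#{k ≤ n : x_k ∈ (p_c, y]} / #{e ∈ E(I_n) : U_e ∈ (p_c, y]} → 0` — the invasion examines a positive fraction `≈ y − p_c` of its labels in `(p_c, y]`
(Prop. 2.1, file XV) but accepts only `o(n)` of them (the outlets have zero density, file XI).  CCN's Theorem 4.2 (`a_n(x) → 0` for `x > p_c`) in
counting form. [cite: ChayesChayesNewman1985, Thm 4.2 and Corollary to Thm 3.2] -/
theorem ae_tendsto_acceptanceRatio_above_criticalProb_zero (hd : 2 ≤ d) {y : ℝ} (hy : criticalProb (zdGraph d) (0 : Site d) < y) (hy1 : y ≤ 1) :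
    ∀ᵐ U ∂(labelMeasure (Site d)), Tendsto (fun n : ℕ =>
      (((Finset.range (n + 1)).filter fun k => acceptedLabel (zdGraph d) U 0 k ∈ Set.Ioc (criticalProb (zdGraph d) (0 : Site d)) y).card : ℝ)
        / (((invasion (zdGraph d) U 0 n).biUnion fun v => (zdGraph d).incidenceFinset v).filter
            fun e => U e ∈ Set.Ioc (criticalProb (zdGraph d) (0 : Site d)) y).card) atTop (𝓝 0) := by
  haveI : Nonempty (Fin d) := ⟨⟨0, by omega⟩⟩
  haveI : Infinite (Site d) := Pi.infinite_of_right
  set pc := criticalProb (zdGraph d) (0 : Site d) with hpc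
  have hpc0 : 0 ≤ pc := (criticalProb_mem_Icc (zdGraph d) (0 : Site d)).1
  have hΔ : ∀ v : Site d, (zdGraph d).degree v ≤ 2 * d := fun v => by
    rw [← SimpleGraph.card_neighborFinset_eq_degree, card_neighborFinset_zdGraph_holds v]
  have hε : 0 < (y - pc) / 4 := by linarith
  filter_upwards [ae_tendsto_badCount_criticalProb_div_zero hd,
    ae_eventually_abs_dev_le zdGraph_preconnected_holds hΔ 0 hpc0 (hy.le.trans hy1) hε,
    ae_eventually_abs_dev_le zdGraph_preconnected_holds hΔ 0 (hpc0.trans hy.le) hy1 hε] with U hM hDpc hDy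
  -- numerator ≤ M_{n+1}(p_c); denominator ≥ (y - p_c)/2 · (n + 1) eventually
  have hM' : Tendsto (fun n : ℕ => (badCount (zdGraph d) U 0 pc (n + 1) : ℝ) / ((n : ℝ) + 1)) atTop (𝓝 0) := by
    have h := hM.comp (tendsto_add_atTop_nat 1)
    refine (tendsto_congr fun n => ?_).1 h
    simp only [Function.comp_apply, Nat.cast_add, Nat.cast_one, hpc]
  have hbound : ∀ᶠ n : ℕ in atTop,
      (((Finset.range (n + 1)).filter fun k => acceptedLabel (zdGraph d) U 0 k ∈ Set.Ioc pc y).card : ℝ)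
        / (((invasion (zdGraph d) U 0 n).biUnion fun v => (zdGraph d).incidenceFinset v).filter fun e => U e ∈ Set.Ioc pc y).card
      ≤ (badCount (zdGraph d) U 0 pc (n + 1) : ℝ) / ((n : ℝ) + 1) * (2 / (y - pc)) := by
    filter_upwards [hDpc, hDy] with n hnpc hny
    set E := (invasion (zdGraph d) U 0 n).biUnion fun v => (zdGraph d).incidenceFinset v with hE
    have hL : (n : ℝ) + 1 ≤ E.card := by exact_mod_cast succ_le_card_biUnion_incidenceFinset_invasion zdGraph_preconnected_holds U 0 n
    -- numerator ≤ M_{n+1}(p_c)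
    have hnum : ((Finset.range (n + 1)).filter fun k => acceptedLabel (zdGraph d) U 0 k ∈ Set.Ioc pc y).card
        ≤ badCount (zdGraph d) U 0 pc (n + 1) :=
      card_le_card fun k hk => by
        rw [mem_filter] at hk ⊢
        exact ⟨hk.1, hk.2.1⟩
    -- denominator = (y - p_c) L_n + D_n(y) - D_n(p_c) ≥ (y - p_c)/2 (n+1)
    have hdev : ∀ z : ℝ, ((E.filter fun e => U e ≤ z).card : ℝ) = z * E.card + ∑ e ∈ E, ((if U e ≤ z then (1 : ℝ) else 0) - z) := by
      intro z
      rw [sum_sub_distrib, sum_const, nsmul_eq_mul, mul_comm (E.card : ℝ) z, ← sum_boole]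
      ring
    have hden : (y - pc) / 2 * ((n : ℝ) + 1) ≤ ((E.filter fun e => U e ∈ Set.Ioc pc y).card : ℝ) := by
      have hsub : (E.filter fun e => U e ≤ pc) ⊆ E.filter fun e => U e ≤ y :=
        fun e he => by rw [mem_filter] at he ⊢; exact ⟨he.1, he.2.trans hy.le⟩
      have hsd : (E.filter fun e => U e ∈ Set.Ioc pc y) = (E.filter fun e => U e ≤ y) \ E.filter fun e => U e ≤ pc := by
        ext e; simp only [mem_filter, Finset.mem_sdiff, Set.mem_Ioc, not_and, not_le]
        constructor
        · rintro ⟨he, hxe, hey⟩; exact ⟨⟨he, hey⟩, fun _ => hxe⟩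
        · rintro ⟨⟨he, hey⟩, h⟩; exact ⟨he, h he, hey⟩
      rw [hsd, card_sdiff_of_subset hsub, Nat.cast_sub (card_le_card hsub), hdev y, hdev pc]
      have h1 := neg_abs_le (∑ e ∈ E, ((if U e ≤ y then (1 : ℝ) else 0) - y))
      have h2 := le_abs_self (∑ e ∈ E, ((if U e ≤ pc then (1 : ℝ) else 0) - pc))
      nlinarith [hL, hnpc, hny, hy]
    have hdenpos : (0 : ℝ) < ((E.filter fun e => U e ∈ Set.Ioc pc y).card : ℝ) := lt_of_lt_of_le (by positivity) hden
    rw [div_le_iff₀ hdenpos]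
    calc (((Finset.range (n + 1)).filter fun k => acceptedLabel (zdGraph d) U 0 k ∈ Set.Ioc pc y).card : ℝ)
        ≤ badCount (zdGraph d) U 0 pc (n + 1) := by exact_mod_cast hnum
      _ = (badCount (zdGraph d) U 0 pc (n + 1) : ℝ) / ((n : ℝ) + 1) * (2 / (y - pc)) * ((y - pc) / 2 * ((n : ℝ) + 1)) := by
          have hyp : y - pc ≠ 0 := (sub_pos.2 hy).ne'
          field_simp
      _ ≤ (badCount (zdGraph d) U 0 pc (n + 1) : ℝ) / ((n : ℝ) + 1) * (2 / (y - pc))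
          * ((E.filter fun e => U e ∈ Set.Ioc pc y).card : ℝ) := by gcongr
  have hlim : Tendsto (fun n : ℕ => (badCount (zdGraph d) U 0 pc (n + 1) : ℝ) / ((n : ℝ) + 1) * (2 / (y - pc))) atTop (𝓝 0) := by
    simpa using hM'.mul_const (2 / (y - pc))
  exact squeeze_zero' (Eventually.of_forall fun n => by positivity) hbound hlim

end Zd

end Summit.CriticalPhenomena.PercolationContinuityZ3.Theorems.Rsw3

end
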